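/-
# Solo-blind programme on Kontsevich–Zagier, s6 part T5b: Ramanujan's base-3 ladder inside the rules

Beyond the seven real algebraic points at which `Li₂` has a closed "logarithmic" form, there are
relations between the dilogarithm at two or more powers of one argument.  The simplest — often
attributed to Ramanujan —

  `Li₂(1/3) − (1/6) Li₂(1/9) = π²/18 − (log² 3)/6`

is decided here inside the KZ rules: in `Q = FormalRep/relations`

  `6·[D(1/3)] − [D(1/9)] = 2·[Λ₂] − ℓ(3)²`     (`ramanujan_ladder`),

assembled from four chains of moves already landed — the five-term relation at `(1/3, 1/3)`
(`xy = 1/9`, `x ⋆ y = 1/4`, right-hand side `ℓ(4/3)²`), duplication at `1/2` (`[D(1/4)]`), Landen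
at `w = 1/2` (`[D⁻(1/2)]` against `[D(1/3)]`, with `ℓ(3/2)²`), Euler at `1/2` — and the rational
logarithmic relations `ℓ(4/3) = 2ℓ(2) − ℓ(3)`, `ℓ(3/2) = ℓ(3) − ℓ(2)` (`ell_eq_sum_smul`).
-/
import Summits.KontsevichZagierPeriods.KontsevichZagierPeriods.Theorems.SoloBlindFiveTerm

noncomputable section

open MeasureTheory Set
open Literature.NumberTheory.Transcendental
open Literature.NumberTheory.Transcendental.KZ
open Literature.NumberTheory.Transcendental.KZ.IntegralRep

namespace Summit.KontsevichZagierPeriods.KontsevichZagierPeriods.Theorems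

namespace SoloBlind

/-! ## The cuts `1/2`, `1/3` and the identifications `1/9`, `1/4`, `1/3` -/

/-- `3` is algebraic. -/
theorem isAlgebraic_three : IsAlgebraic ℚ (3 : ℝ) := by
  simpa using isAlgebraic_nat (R := ℚ) (A := ℝ) 3

/-- The cut `1/2`. -/
def cutHalf : Cut :=
  ⟨2⁻¹, by simpa using (isAlgebraic_nat (R := ℚ) (A := ℝ) 2).inv, by norm_num, by norm_num⟩

/-- The cut `1/3`. -/
def cutThird : Cut := ⟨3⁻¹, isAlgebraic_three.inv, by norm_num, by norm_num⟩

/-- Cut point of `1/2`. -/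
@[simp] theorem cutHalf_x : cutHalf.x = 2⁻¹ := rfl

/-- Cut point of `1/3`. -/
@[simp] theorem cutThird_x : cutThird.x = 3⁻¹ := rfl

/-- `1/3 ⋆ 1/3 = 1/4 = (1/2)²`. -/
theorem cutThird_twist_self : cutThird.twist cutThird = cutHalf.sq :=
  Cut.ext (by rw [Cut.twist_x, Cut.sq_x, cutThird_x, cutHalf_x]; norm_num)

/-- `1 − 1/2 = 1/2`. -/
theorem cutHalf_symm : cutHalf.symm = cutHalf :=
  Cut.ext (by show (1 : ℝ) - 2⁻¹ = 2⁻¹; norm_num)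

/-- Landen's cut of `w = 1/2` is `w/(1+w) = 1/3`. -/
theorem ofPos_half : Cut.ofPos cutHalf.alg cutHalf.pos = cutThird :=
  Cut.ext (by rw [Cut.ofPos_x, cutHalf_x, cutThird_x]; norm_num)

/-! ## The rational logarithmic relations -/

/-- `ℓ(4/3) = 2ℓ(2) − ℓ(3)`. -/
theorem ell_four_thirds : ell (4 / 3) = 2 * ell 2 - ell 3 := by
  have h4 : Real.log 4 = 2 * Real.log 2 := by
    rw [show (4 : ℝ) = 2 ^ 2 by norm_num, Real.log_pow, Nat.cast_ofNat]
  have h2 : IsAlgebraic ℚ (2 : ℝ) := by simpa using isAlgebraic_nat (R := ℚ) (A := ℝ) 2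
  have h := ell_eq_sum_smul (isAlgebraic_three.inv.mul (h2.pow 2))
    (show (1 : ℝ) < 3⁻¹ * 2 ^ 2 by norm_num) ![2, 3]
    (fun k => by fin_cases k <;> [exact h2; exact isAlgebraic_three])
    (fun k => by fin_cases k <;> norm_num) ![2, -1]
    (by
      rw [Fin.sum_univ_two, show (3⁻¹ : ℝ) * 2 ^ 2 = 4 / 3 by norm_num,
        Real.log_div (by norm_num) (by norm_num), h4]
      simp
      ring)
  rw [show (4 / 3 : ℝ) = 3⁻¹ * 2 ^ 2 by norm_num, h, Fin.sum_univ_two]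
  simp only [Matrix.cons_val_zero, Matrix.cons_val_one, Rat.cast_ofNat,
    Rat.cast_neg, Rat.cast_one, neg_smul, one_smul, ofNat_smul_eq_nsmul, nsmul_eq_mul,
    Nat.cast_ofNat]
  ring

/-- `ℓ(3/2) = ℓ(3) − ℓ(2)`. -/
theorem ell_three_halves : ell (1 + 2⁻¹) = ell 3 - ell 2 := by
  have h2 : IsAlgebraic ℚ (2 : ℝ) := by simpa using isAlgebraic_nat (R := ℚ) (A := ℝ) 2
  have h := ell_eq_sum_smul (isAlgebraic_one.add h2.inv)
    (show (1 : ℝ) < 1 + 2⁻¹ by norm_num) ![3, 2]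
    (fun k => by fin_cases k <;> [exact isAlgebraic_three; exact h2])
    (fun k => by fin_cases k <;> norm_num) ![1, -1]
    (by
      rw [Fin.sum_univ_two, show (1 + 2⁻¹ : ℝ) = 3 / 2 by norm_num,
        Real.log_div (by norm_num) (by norm_num)]
      simp
      ring)
  rw [h, Fin.sum_univ_two]
  simp only [Matrix.cons_val_zero, Matrix.cons_val_one, Rat.cast_neg, Rat.cast_one, neg_smul,
    one_smul]
  ring

/-! ## The ladder -/

/-- **Ramanujan's base-3 ladder as an identity of KZ classes:**
`6·[D(1/3)] − [D(1/9)] = 2·[Λ₂] − ℓ(3)²` in `Q`. -/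
theorem ramanujan_ladder : 6 * mkQ (of (dilogCut cutThird)) -
    mkQ (of (dilogCut (cutThird.mul cutThird))) = 2 * mkQ (of simplexTwo) - ell 3 ^ 2 := by
  have hF := five_term cutThird cutThird
  have hA : (cutThird.twist cutThird).x⁻¹ * cutThird.x = 4 / 3 := by
    rw [Cut.twist_x, cutThird_x]; norm_num
  have hB : (1 - (cutThird.twist cutThird).x)⁻¹ = 4 / 3 := by
    rw [Cut.twist_x, cutThird_x]; norm_num
  rw [hA, hB, cutThird_twist_self, ell_four_thirds] at hF
  have hD := two_nsmul_mkQ_dilogCut cutHalf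
  have hL := two_nsmul_mkQ_dilogNeg cutHalf.alg cutHalf.pos
  have e3 : ell (1 + cutHalf.x) = ell 3 - ell 2 := ell_three_halves
  rw [ofPos_half, e3] at hL
  have hE := mkQ_simplexTwo_cut cutHalf
  rw [cutHalf_symm, cutHalf_x, inv_inv, show (1 - 2⁻¹ : ℝ)⁻¹ = 2 by norm_num] at hE
  simp only [nsmul_eq_mul, Nat.cast_ofNat] at hD hL
  linear_combination hF - 2 * hD - 2 * hL - 2 * hE

/-- **Period shadow (Ramanujan):** `6 Li₂(1/3) − Li₂(1/9) = π²/3 − log² 3`, i.e.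
`6·value D(1/3) − value D(1/9) = π²/3 − log² 3` (`D(1/9)` is the cut `3⁻¹·3⁻¹`). -/
theorem ramanujan_ladder_value : 6 * (dilogCut cutThird).value -
    (dilogCut (cutThird.mul cutThird)).value = Real.pi ^ 2 / 3 - Real.log 3 ^ 2 := by
  have h := congrArg evalQ ramanujan_ladder
  rw [map_sub, map_sub, map_mul, map_mul, map_pow, map_ofNat, map_ofNat, evalQ_mkQ, evalQ_mkQ,
    evalQ_mkQ, eval_of, eval_of, eval_of, simplexTwo_value,
    evalQ_ell isAlgebraic_three (by norm_num)] at h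
  rw [h]
  ring

/-- The cut point of `D(1/9)`: `3⁻¹·3⁻¹ = 9⁻¹`. -/
theorem cutThird_mul_self_x : (cutThird.mul cutThird).x = 9⁻¹ := by
  rw [Cut.mul_x, cutThird_x]; norm_num

end SoloBlind

end Summit.KontsevichZagierPeriods.KontsevichZagierPeriods.Theorems
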